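import Summits.CriticalPhenomena.PercolationContinuityZ3.Theorems.PercNearOneGluingNoHeavyLowerTailSahiCombTriWCone
import Summits.CriticalPhenomena.PercolationContinuityZ3.Theorems.PercNearOneGluingNoHeavyLowerTailSahiCombTriWDisjointGen

/-!
# `TriWIneq` for STARS `x_g ∧ (⋁_{i∈h} x_i)`: `P = {t | g ⊆ t ∧ t ∩ h ≠ ∅}`, `g ∩ h = ∅` (free coordinates allowed), all `n`, all `a`

Support file of the one-cut programme (crux `NoHeavyLowerTail`, stmt-CriticalPhenomena-4575; unit `prim-lf-1` gen 41, memo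
`FROM-prim-lf-1-gen41-SHELLS-AND-OR-PRODUCTS.md` §5).  First concrete corollary of the CONE THEOREM (`…SahiCombTriWCone`): split the ground set along the
apex `g`; in the complement block the family "meets `h`" is saturated (hence a Kleitman shell), and the star is its cone.  These are the classes
`x₀(x₁∨x₂)`, `x₀(x₁∨x₂∨x₃)`, `x₀x₁(x₂∨x₃∨x₄)`, … of P5's census (no 0/1 antipodal certificate; diagonal LP weights `1 − 1/k, 1, 2`), now theorems for every
apex `g ≠ ∅`, every `h ≠ ∅` disjoint from `g`, and any number of free coordinates.

* `FiveUpSet.star g h`, `isUpperSet_star`; `FiveUpSet.meetBlock g h` (the family "meets `h`" inside the block `{a ∉ g}`), `meetBlock_saturated`;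
* `FiveUpSet.famMap_star` — `famMap (blockEquiv g) (star g h) = andTop (meetBlock g h)`;
* `FiveUpSet.coneFam`, **`triW_nonneg_coneFam`**, `FiveUpSet.orFam`, **`triW_nonneg_orFam`**, `klShell_orFam` — the cone and OR-product theorems read on an arbitrary
  ground type `γ` with a block `g` (families of the blocks `{a ∈ g}`, `{a ∉ g}`);
* **`FiveUpSet.triW_nonneg_star`** — `Disjoint g h`, `h ≠ ∅` (any `g`, `g = ∅` being the saturated family "meets `h`") ⟹ `0 ≤ triW (star g h) F G` for every index cube and all monotone families of up-sets.
HONEST LABEL: complete proofs, std axioms; a new unconditional stratum; `TriWIneq` itself stays OPEN. [this work]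
-/

namespace Summit.CriticalPhenomena.PercolationContinuityZ3.Theorems

namespace FiveUpSet

open Finset

variable {β γ : Type} [DecidableEq β] [Fintype β] [DecidableEq γ] [Fintype γ]

/-- The star `x_g ∧ (⋁_{i ∈ h} x_i)`: sets containing `g` and meeting `h`. [this work] -/
def star (g h : Finset γ) : Finset (Finset γ) := univ.filter fun t => g ⊆ t ∧ (t ∩ h).Nonempty

omit [DecidableEq β] [Fintype β] in
/-- Membership in the star. [this work] -/
@[simp] theorem mem_star {g h t : Finset γ} : t ∈ star g h ↔ g ⊆ t ∧ (t ∩ h).Nonempty := by simp [star]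

omit [DecidableEq β] [Fintype β] in
/-- The star is an up-set. [this work] -/
theorem isUpperSet_star (g h : Finset γ) : IsUpperSet (star g h : Set (Finset γ)) := by
  intro t t' htt' ht
  rw [mem_coe, mem_star] at ht ⊢
  exact ⟨ht.1.trans htt', ht.2.mono (inter_subset_inter_right htt')⟩

/-- The family "meets `h`" read inside the complement block of `g`. [this work] -/
def meetBlock (g h : Finset γ) : Finset (Finset {a // a ∉ g}) := univ.filter fun y => ∃ x ∈ y, (x : γ) ∈ h

omit [DecidableEq β] [Fintype β] in
/-- Membership in `meetBlock`. [this work] -/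
@[simp] theorem mem_meetBlock {g h : Finset γ} {y : Finset {a // a ∉ g}} : y ∈ meetBlock g h ↔ ∃ x ∈ y, (x : γ) ∈ h := by simp [meetBlock]

omit [DecidableEq β] [Fintype β] in
/-- `meetBlock` is an up-set. [this work] -/
theorem isUpperSet_meetBlock (g h : Finset γ) : IsUpperSet (meetBlock g h : Set (Finset {a // a ∉ g})) := by
  intro y y' hyy' hy
  rw [mem_coe, mem_meetBlock] at hy ⊢
  obtain ⟨x, hx, hxh⟩ := hy
  exact ⟨x, hyy' hx, hxh⟩

omit [DecidableEq β] [Fintype β] in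
/-- `meetBlock g h` is saturated in its block when `h ≠ ∅` is disjoint from `g`. [this work] -/
theorem meetBlock_saturated {g h : Finset γ} (hgh : Disjoint g h) (hh : h.Nonempty) (y : Finset {a // a ∉ g}) :
    y ∈ meetBlock g h ∨ yᶜ ∈ meetBlock g h := by
  obtain ⟨a, ha⟩ := hh
  have hag : a ∉ g := fun hag => disjoint_left.1 hgh hag ha
  by_cases hy : (⟨a, hag⟩ : {a // a ∉ g}) ∈ y
  · exact Or.inl (mem_meetBlock.2 ⟨_, hy, ha⟩)
  · exact Or.inr (mem_meetBlock.2 ⟨_, mem_compl.2 hy, ha⟩)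

omit [DecidableEq β] [Fintype β] in
/-- **The relabeled star is the cone over `meetBlock`.** [this work] -/
theorem famMap_star {g h : Finset γ} (hgh : Disjoint g h) :
    famMap (blockEquiv g) (star g h) = andTop (meetBlock g h) := by
  ext s
  rw [mem_famMap, mem_star, mem_andTop, mem_meetBlock]
  have hL : g ⊆ s.map (blockEquiv g).symm.toEmbedding ↔ s.toLeft = univ := by
    constructor
    · intro hsub
      exact eq_univ_of_forall fun x => mem_toLeft.2 ((inl_mem_iff x).1 (hsub x.2))
    · intro hsub a ha
      have := hsub ▸ mem_univ (⟨a, ha⟩ : {a // a ∈ g})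
      rw [mem_toLeft] at this
      exact (inl_mem_iff ⟨a, ha⟩).2 this
  have hR : (s.map (blockEquiv g).symm.toEmbedding ∩ h).Nonempty ↔ ∃ x ∈ s.toRight, (x : γ) ∈ h := by
    constructor
    · rintro ⟨a, ha⟩
      rw [mem_inter] at ha
      have hag : a ∉ g := fun hag => disjoint_left.1 hgh hag ha.2
      exact ⟨⟨a, hag⟩, mem_toRight.2 ((inr_mem_iff ⟨a, hag⟩).1 ha.1), ha.2⟩
    · rintro ⟨x, hx, hxh⟩
      rw [mem_toRight] at hx
      exact ⟨x, mem_inter.2 ⟨(inr_mem_iff x).2 hx, hxh⟩⟩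
  rw [hL, hR]

/-- **`TriWIneq` for stars**: `Disjoint g h`, `h ≠ ∅` ⟹ `0 ≤ triW (star g h) F G` for EVERY index cube `Finset β` and all monotone families `F, G` of
up-sets of `Finset γ` (coordinates outside `g ∪ h` are free). [this work] -/
theorem triW_nonneg_star {g h : Finset γ} (hgh : Disjoint g h) (hh : h.Nonempty)
    (F G : Finset β → Finset (Finset γ))
    (hF : ∀ x, IsUpperSet (F x : Set (Finset γ))) (hG : ∀ x, IsUpperSet (G x : Set (Finset γ)))
    (hFm : Monotone F) (hGm : Monotone G) :
    0 ≤ triW (star g h) F G := by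
  refine triW_nonneg_of_famMap (blockEquiv g) (fun F' G' hF' hG' hF'm hG'm => ?_) F G hF hG hFm hGm
  rw [famMap_star hgh]
  exact triW_nonneg_andTop (isUpperSet_meetBlock g h) (klShell_of_saturated (meetBlock_saturated hgh hh)) F' G' hF' hG' hF'm hG'm


/-! ### General block wrappers on an arbitrary ground type -/

/-- The cone with apex `g` over a family `Q` of the complement block, as a family on `γ`: `{t | g ⊆ t ∧ t|_{gᶜ} ∈ Q}`. [this work] -/
def coneFam (g : Finset γ) (Q : Finset (Finset {a // a ∉ g})) : Finset (Finset γ) := famMap (blockEquiv g).symm (andTop Q)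

/-- **Cone theorem on an arbitrary ground type**: if `Q` (a family of the block `{a ∉ g}`) is an up-set with a Kleitman shell, then
`0 ≤ triW (coneFam g Q) F G` for every index cube and all monotone families of up-sets of `Finset γ`. [this work] -/
theorem triW_nonneg_coneFam (g : Finset γ) {Q : Finset (Finset {a // a ∉ g})} (hQ : IsUpperSet (Q : Set (Finset {a // a ∉ g})))
    (hT : KlShell (Q ∪ refl Q)) (F G : Finset β → Finset (Finset γ))
    (hF : ∀ x, IsUpperSet (F x : Set (Finset γ))) (hG : ∀ x, IsUpperSet (G x : Set (Finset γ)))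
    (hFm : Monotone F) (hGm : Monotone G) :
    0 ≤ triW (coneFam g Q) F G := by
  refine triW_nonneg_of_famMap (blockEquiv g) (fun F' G' hF' hG' hF'm hG'm => ?_) F G hF hG hFm hGm
  unfold coneFam
  rw [famMap_famMap_symm]
  exact triW_nonneg_andTop hQ hT F' G' hF' hG' hF'm hG'm

/-- The OR-product of a family `P₁` of the block `g` and a family `P₂` of the block `gᶜ`, as a family on `γ`: `{t | t|_g ∈ P₁ ∨ t|_{gᶜ} ∈ P₂}`. [this work] -/
def orFam (g : Finset γ) (P₁ : Finset (Finset {a // a ∈ g})) (P₂ : Finset (Finset {a // a ∉ g})) : Finset (Finset γ) :=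
  famMap (blockEquiv g).symm (orProd P₁ P₂)

/-- **OR-product theorem on an arbitrary ground type**: up-sets `P₁` (block `g`) and `P₂` (block `gᶜ`) with Kleitman shells ⟹
`0 ≤ triW (orFam g P₁ P₂) F G` for every index cube and all monotone families of up-sets of `Finset γ`. [this work] -/
theorem triW_nonneg_orFam (g : Finset γ) {P₁ : Finset (Finset {a // a ∈ g})} {P₂ : Finset (Finset {a // a ∉ g})}
    (hP₁ : IsUpperSet (P₁ : Set (Finset {a // a ∈ g}))) (hP₂ : IsUpperSet (P₂ : Set (Finset {a // a ∉ g})))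
    (h₁ : KlShell (P₁ ∪ refl P₁)) (h₂ : KlShell (P₂ ∪ refl P₂)) (F G : Finset β → Finset (Finset γ))
    (hF : ∀ x, IsUpperSet (F x : Set (Finset γ))) (hG : ∀ x, IsUpperSet (G x : Set (Finset γ)))
    (hFm : Monotone F) (hGm : Monotone G) :
    0 ≤ triW (orFam g P₁ P₂) F G := by
  refine triW_nonneg_of_famMap (blockEquiv g) (fun F' G' hF' hG' hF'm hG'm => ?_) F G hF hG hFm hGm
  unfold orFam
  rw [famMap_famMap_symm]
  exact triW_nonneg_orProd hP₁ hP₂ h₁ h₂ F' G' hF' hG' hF'm hG'm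

/-- The shell of an OR-family on `γ` is a Kleitman shell (so OR-families can be nested / fed into cones). [this work] -/
theorem klShell_orFam (g : Finset γ) {P₁ : Finset (Finset {a // a ∈ g})} {P₂ : Finset (Finset {a // a ∉ g})}
    (h₁ : KlShell (P₁ ∪ refl P₁)) (h₂ : KlShell (P₂ ∪ refl P₂)) : KlShell (orFam g P₁ P₂ ∪ refl (orFam g P₁ P₂)) := by
  unfold orFam
  rw [refl_famMap, ← famMap_union]
  exact klShell_famMap _ (klShell_orProd h₁ h₂)

end FiveUpSet

end Summit.CriticalPhenomena.PercolationContinuityZ3.Theorems
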